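import Summits.BirchSwinnertonDyer.BirchSwinnertonDyer.Theses.ClassRecordThree
import HarnessLib

/-!
# Route `ClassRecordThree` — the Assembly item, discharged

Cell `bsd-stepL` (run/shared/lean/pub/bsd-stepL/), seat `bsd-stepL-bdp` (prover), D-0059 ∕ D-0061
rung-K2@3 route `route-BirchSwinnertonDyer-ClassRecordThree` (planner g19; leaf
`Summit.BirchSwinnertonDyer.Rank1Residual.X11b.MultiplicativeRankOneAtThree`, p404842; import hub
p405590).

The route's `Assembly` item (`stmt-BirchSwinnertonDyer-19113`) is the implication
`SchneiderAtThree → HalvesAtThree → HsiehDescentAtThree → EulerHalvesAtThree → ShimuraDisplaysAtThree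
→ CornerAtThree → PublishedInputsThree → X11b.MultiplicativeRankOneAtThree`: pure re-plumbing of the
cell's kernel class record `Three.forall_bsdp_of_classRecord_v45'` (X11b/Three/ClassRecordEP.lean)
through the leaf glue `X11b.multiplicativeRankOneAtThree_of_classRecord` (X11b/RungK2Leaves.lean §2).
This file proves it with the SAME term the route's deciding theorem `closes` uses inline (planner's
`gluetest-ClassRecordThree.lean`, farm rc 0): destructure the support conjunction into its twenty
named facts, split the six grouped cruxes back into the twelve kernel binders, apply the glue.
Nothing mathematical is claimed beyond the kernel record; the six cruxes and the twenty published
facts remain hypotheses of the implication. HONEST FRAMING: this closes the ASSEMBLY item only — no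
crux, no class of atom O2@3, no census word.

References: [Castella2018] F. Castella, Camb. J. Math. 6 (2018), §5; [JetchevSkinnerWan2017] §7.4;
[Hsieh2014] M.-L. Hsieh, Doc. Math. 19 (2014).
-/

namespace Summit.BirchSwinnertonDyer.BirchSwinnertonDyer.Theorems

/-- **The Assembly item of route `ClassRecordThree` holds**: the six cruxes `SchneiderAtThree`,
`HalvesAtThree`, `HsiehDescentAtThree`, `EulerHalvesAtThree`, `ShimuraDisplaysAtThree`, `CornerAtThree`
and the support conjunction `PublishedInputsThree` imply the rung-K2@3 leaf
`X11b.MultiplicativeRankOneAtThree` — by the tree's kernel glue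
`X11b.multiplicativeRankOneAtThree_of_classRecord` (= the class record v4.5′ re-plumbed), the grouped
cruxes being split into the twelve kernel binders by projections. Same term as the route's `closes`.
[cite: Castella2018, §5 (arXiv:1704.06608 p. 12) (assembly shape at p ∣ N)]
[cite: JetchevSkinnerWan2017, §7.4 (arXiv:1512.06894 pp. 29–31)] -/
theorem classRecordThree_assembly_holds :
    Summit.BirchSwinnertonDyer.BirchSwinnertonDyer.Theses.ClassRecordThree.Assembly := by
  intro g₁ g₂ g₃ g₄ g₅ g₆ g₇
  obtain ⟨hGZ, hKo, hB, hSk, hWu, hGZK, hmod, hnf, hHL, hMaz, hPT, hFH, hBR, hSkA, hJn, hHn, hD,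
    hpar, hMN, hH⟩ := g₇
  exact Summit.BirchSwinnertonDyer.Rank1Residual.X11b.multiplicativeRankOneAtThree_of_classRecord
    hGZ hKo hB hSk hWu hGZK hmod hnf hHL hMaz hPT hFH hBR hSkA hJn hHn hD hpar hMN hH g₁
    (fun W _ _ hX ↦ (g₃ W hX).1) (fun W _ _ hX ↦ (g₃ W hX).2)
    (fun W _ _ hX ↦ (g₂ W hX).1) (fun W _ _ hX ↦ (g₂ W hX).2) g₅
    (fun W _ _ hX ↦ (g₄ W hX).1) (fun W _ _ hX ↦ (g₄ W hX).2.1) (fun W _ _ hX ↦ (g₄ W hX).2.2)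
    (fun W _ _ ↦ (g₆ W).1) (fun W _ _ ↦ (g₆ W).2.1) (fun W _ _ ↦ (g₆ W).2.2)

end Summit.BirchSwinnertonDyer.BirchSwinnertonDyer.Theorems
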